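import Summits.BirchSwinnertonDyer.Rank1Residual.Additive.UniversalNormTransportTools
import Literature.NumberTheory.EllipticCurves.IsogenyLocalPointsMaps
import HarnessLib

/-!
# (T3) The twist transport of Mazur's universal norms, abstract form: Step A
# (`ℚ_p`-universal norms = `K_𝔭`-universal norms on `E(ℚ_p)`) and the tools on the twist side

HONEST FRAMING (cell `bsd-addord`, `run/shared/lean/pub/bsd-addord/README.md` §4; seat
`bsd-addord-twist`, strategy = twist transport; T-ANOM route R1, item (T3), TARGET.md S36‴/S41 «the 177
anomalous r1 keys wait on twist (T3) transport»): the programme's target of record is the full BSD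
formula for every `E/ℚ` of analytic rank `≤ 1`; this is a TOOL file (theorems only: no definition, no named fact, no `sorry`).

## Setting and content

`X/K` a Weierstrass model, `d ∈ K`, `E ⊇ K` a field, `θ ∈ K̄_E` with `σ θ = ±θ` for all `σ ∈ Γ_E`
(e.g. `θ = geomSqrt d`); `S = Stab_{Γ_E}(θ)` (`= Γ_{E(θ)}`); `κ` a `ℤ_p`-extension of `K` with `p`
ODD, layers `Γ_n = localLayer E κ ⊤ n`, `S_n = S ∩ Γ_n = localLayer E κ S n`; and (§7) ANY additive
isomorphism `ι : X^{(d)}(K̄_E) ≃+ X(K̄_E)` obeying the SIGN RULE `ι(σ P) = ±σ ι(P)` according as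
`σ θ = ±θ` (hypotheses `hι₁`, `hι₂`) — instantiated over `ℚ` by the tree's `untwistEquivAt`,
`(x, y) ↦ (x/θ², y/θ³)`, for a model with `a₁ = a₃ = 0` (§6; `Literature/…/IsogenyLocalPointsMaps.lean`).
* §4 `S` is normal; **`Γ_E = S · Γ_n`** for every `n` (for `g ∉ S`: `g² ∈ S` and `g^{[Γ_E:Γ_n]} ∈ Γ_n`
  with `[Γ_E : Γ_n] ∣ pⁿ` odd) — no computation of `[Γ_E : S]` is needed; if `θ ∉ E`, every layer
  contains an involution `τ_n` of `θ`.
* §6 the SIGN RULE `ι(σ P) = ±σ ι(P)` according as `σ θ = ±θ` (the tree's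
  `map_untwistEquivAt_of_eq/_of_eq_neg`): the Galois module `X^{(d)}(K̄_E)` is `X(K̄_E)` twisted by the
  quadratic character of `E(θ)/E` [Silverman, *AEC* X.2 Prop. 2.4, X.5 Cor. 5.4].
* §7.1–7.3 `ι` carries `Γ_n`-fixed points of the twist to `S_n`-fixed, `τ_n`-ANTI-fixed points of `X`
  and back (`symm_mem_localFixedPoints_localLayer`), and **`ι ∘ N_{Γ_E/Γ_n} = N_{S/S_n} ∘ ι`**.
* §7.4 **Step A**: for `m ∈ X(E) = E_X(K̄_E)^{Γ_E}`, if the universal-norm index over `E` is ODD then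
  `m ∈ N_∞^{E}` iff `m ∈ N_∞^{E(θ)}` (`mem_universalNorms_top_iff_stabilizer`; «⟸» symmetrises a
  `K_n`-preimage by `τ_n`, giving `2m ∈ N_∞^{E}`).
Steps B–D and the `ℚ` instance: `UniversalNormTwistTransportRat.lean`.

References: B. Mazur, Invent. Math. 18 (1972) §4–§5, Cor. 5.15 + Remark p. 229 [Mazur1972Towers];
D. Delbourgo, J. Number Theory 95 (2002) p. 61 (Remark: `E(K_{v_p})/N_∞ ≅ E(ℚ_p)/N_∞ × (E ⊗ Ψ_K)(ℚ_p)/N_∞`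
in the split multiplicative case — the shape transported here), p. 67 (iv), p. 69 [Delbourgo2002];
J. W. Jones, J. Number Theory 51 (1995) Lemma 4.1 (the same decomposition for a quadratic twist;
corroboration only); J. H. Silverman, *AEC* 2nd ed., X.2 Prop. 2.4, X.5 Cor. 5.4 [SilvermanAEC2009].
-/

noncomputable section

open scoped Classical

universe u

namespace Summit.BirchSwinnertonDyer.Rank1Residual.Additive.UniversalNormTwist

open WeierstrassCurve Field Literature.NumberTheory.EllipticCurves

variable {K : Type u} [Field K] {E : Type u} [Field E] [Algebra K E]

/-! ## §4 The stabiliser `S` of `θ = √d` and the decomposition `Γ_E = S · Γ_n` -/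

section Stabilizer

variable {θ : AlgebraicClosure E}
  (hθ : ∀ σ : absoluteGaloisGroup E, σ • θ = θ ∨ σ • θ = -θ)

include hθ in
/-- Outside the stabiliser, `σ • θ = -θ`. [folklore] -/
theorem smul_eq_neg_of_not_mem {σ : absoluteGaloisGroup E}
    (hσ : σ ∉ MulAction.stabilizer (absoluteGaloisGroup E) θ) : σ • θ = -θ :=
  (hθ σ).resolve_left hσ

/-- If `τ • θ = -θ` then `τ⁻¹ • θ = -θ`. [folklore] -/
theorem inv_smul_eq_neg {τ : absoluteGaloisGroup E} (hτ : τ • θ = -θ) : τ⁻¹ • θ = -θ := by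
  have h := congrArg (τ⁻¹ • ·) hτ
  simp only [inv_smul_smul, smul_neg] at h
  rw [← neg_eq_iff_eq_neg]
  exact h.symm

/-- If `τ • θ = -θ` then `τ² ∈ S`. [folklore] -/
theorem sq_mem_stabilizer {τ : absoluteGaloisGroup E} (hτ : τ • θ = -θ) :
    τ ^ 2 ∈ MulAction.stabilizer (absoluteGaloisGroup E) θ := by
  rw [MulAction.mem_stabilizer_iff, pow_two, mul_smul, hτ, smul_neg, hτ, neg_neg]

/-- If `τ • θ = -θ` and `σ • θ = -θ` then `τ⁻¹ σ ∈ S`. [folklore] -/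
theorem inv_mul_mem_stabilizer {τ σ : absoluteGaloisGroup E} (hτ : τ • θ = -θ) (hσ : σ • θ = -θ) :
    τ⁻¹ * σ ∈ MulAction.stabilizer (absoluteGaloisGroup E) θ := by
  rw [MulAction.mem_stabilizer_iff, mul_smul, hσ, smul_neg, inv_smul_eq_neg hτ, neg_neg]

include hθ in
/-- **The stabiliser of `θ` is normal** (its conjugates stabilise `±θ`). [folklore] -/
theorem normal_stabilizer : (MulAction.stabilizer (absoluteGaloisGroup E) θ).Normal := by
  refine ⟨fun σ hσ g ↦ ?_⟩
  rw [MulAction.mem_stabilizer_iff] at hσ ⊢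
  rcases hθ g⁻¹ with hg | hg
  · have hg' : g • θ = θ := by
      have := congrArg (g • ·) hg; simpa using this.symm
    rw [mul_smul, mul_smul, hg, hσ, hg']
  · have hg' : g • θ = -θ := by
      have := congrArg (g • ·) hg
      simp only [smul_inv_smul, smul_neg] at this
      rw [← neg_eq_iff_eq_neg]; exact this.symm
    rw [mul_smul, mul_smul, hg, smul_neg, hσ, smul_neg, hg', neg_neg]

include hθ in
/-- **`Γ_E = S · L` for every normal subgroup `L` of finite ODD index**: for `g ∉ S`, `g² ∈ S`
and `g^{[Γ_E : L]} ∈ L` with `[Γ_E : L]` odd. [folklore] -/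
theorem exists_stabilizer_mul_of_odd_index (L : Subgroup (absoluteGaloisGroup E)) [L.Normal]
    [L.FiniteIndex] (hodd : Odd L.index) (g : absoluteGaloisGroup E) :
    ∃ s ∈ MulAction.stabilizer (absoluteGaloisGroup E) θ, ∃ l ∈ L, g = s * l := by
  rcases hθ g with hg | hg
  · exact ⟨g, hg, 1, L.one_mem, (mul_one g).symm⟩
  · obtain ⟨k, hk⟩ := hodd
    refine ⟨((g ^ 2) ^ k)⁻¹, Subgroup.inv_mem _ (Subgroup.pow_mem _ (sq_mem_stabilizer hg) k),
      g ^ L.index, L.pow_index_mem g, ?_⟩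
    rw [hk, show g ^ (2 * k + 1) = (g ^ 2) ^ k * g by rw [pow_succ, pow_mul], inv_mul_cancel_left]

end Stabilizer

/-! ## §6 The untwisting isomorphism `ι : E^{(d)}(K̄_E) ≃+ E(K̄_E)` and its sign rule -/

section Twist

variable [NeZero (2 : K)] (X : WeierstrassCurve K) [X.IsCharNeTwoNF] {d : K}
  {θ : AlgebraicClosure E} (hθ2 : θ ^ 2 = algebraMap K (AlgebraicClosure E) d) (hθ0 : θ ≠ 0)


/-- **Sign rule, `+`**: `ι(σ • P) = σ • ι(P)` when `σ √d = √d`. [cite: SilvermanAEC2009, X.5 Cor. 5.4] -/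
theorem untwist_smul_of_eq (σ : absoluteGaloisGroup E) (hσ : σ • θ = θ)
    (P : localPoints (X.quadraticTwist d) E) :
    (@id (localPoints (X.quadraticTwist d) E ≃+ localPoints X E) (untwistEquivAt X hθ2 hθ0)) (σ • P) =
      σ • (@id (localPoints (X.quadraticTwist d) E ≃+ localPoints X E) (untwistEquivAt X hθ2 hθ0)) P := by
  rw [localPoints.smul_def, localPoints.smul_def]
  exact (map_untwistEquivAt_of_eq X hθ2 hθ0 hθ2 hθ0 _ hσ P).symm

/-- **Sign rule, `−`**: `ι(σ • P) = -(σ • ι(P))` when `σ √d = -√d`. [cite: SilvermanAEC2009, X.5 Cor. 5.4] -/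
theorem untwist_smul_of_eq_neg (σ : absoluteGaloisGroup E) (hσ : σ • θ = -θ)
    (P : localPoints (X.quadraticTwist d) E) :
    (@id (localPoints (X.quadraticTwist d) E ≃+ localPoints X E) (untwistEquivAt X hθ2 hθ0)) (σ • P) =
      -(σ • (@id (localPoints (X.quadraticTwist d) E ≃+ localPoints X E) (untwistEquivAt X hθ2 hθ0)) P) := by
  rw [localPoints.smul_def, localPoints.smul_def, eq_neg_iff_add_eq_zero, ← neg_eq_iff_add_eq_zero]
  exact (map_untwistEquivAt_of_eq_neg X hθ2 hθ0 hθ2 hθ0 _ hσ P).symm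

end Twist

/-! ## §7 The transport argument -/

section Main

variable (X : WeierstrassCurve K) {d : K} {θ : AlgebraicClosure E}
  (hθ : ∀ σ : absoluteGaloisGroup E, σ • θ = θ ∨ σ • θ = -θ)
  (ι : localPoints (X.quadraticTwist d) E ≃+ localPoints X E)
  (hι₁ : ∀ σ : absoluteGaloisGroup E, σ • θ = θ →
    ∀ P : localPoints (X.quadraticTwist d) E, ι (σ • P) = σ • ι P)
  (hι₂ : ∀ σ : absoluteGaloisGroup E, σ • θ = -θ →
    ∀ P : localPoints (X.quadraticTwist d) E, ι (σ • P) = -(σ • ι P))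
  {p : ℕ} [Fact p.Prime] (κ : ZpExtension K p) (hp2 : p ≠ 2)


/-! ### §7.1 Layers: odd index, the decomposition `Γ_E = S · Γ_n`, an involution in every layer -/

include hp2 in
/-- The layers have odd index (`[Γ_E : Γ_n] ∣ pⁿ`, `p` odd). [folklore] -/
theorem odd_index_localLayer_top (n : ℕ) : Odd (localLayer E κ ⊤ n).index :=
  ((Fact.out : p.Prime).odd_of_ne_two hp2).pow.of_dvd_nat (index_localLayer_top_dvd E κ n)

include hθ hp2 in
/-- `Γ_E = S · Γ_n`. [folklore] -/
theorem exists_stabilizer_mul_layer (n : ℕ) (g : absoluteGaloisGroup E) :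
    ∃ s ∈ (MulAction.stabilizer (absoluteGaloisGroup E) θ), ∃ l ∈ localLayer E κ ⊤ n, g = s * l :=
  haveI := normal_localLayer_top E κ n
  haveI := finiteIndex_localLayer_top E κ n
  exists_stabilizer_mul_of_odd_index hθ _ (odd_index_localLayer_top κ hp2 n) g

include hθ hp2 in
/-- If `√d ∉ E` (some `τ ∈ Γ_E` moves `θ`), every layer `Γ_n` contains an element negating `θ`.
[folklore] -/
theorem exists_mem_layer_smul_eq_neg (hτ : ∃ τ : absoluteGaloisGroup E, τ • θ ≠ θ) (n : ℕ) :
    ∃ τ ∈ localLayer E κ ⊤ n, τ • θ = -θ := by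
  obtain ⟨τ₀, hτ₀⟩ := hτ
  obtain ⟨s, hs, l, hl, rfl⟩ := exists_stabilizer_mul_layer hθ κ hp2 n τ₀
  refine ⟨l, hl, (hθ l).resolve_left fun h ↦ hτ₀ ?_⟩
  rw [mul_smul, h, MulAction.mem_stabilizer_iff.mp hs]

/-- The layer seen from `S` is normal (`S` and `Γ_n` are). [folklore] -/
theorem normal_localLayer_stabilizer [(MulAction.stabilizer (absoluteGaloisGroup E) θ).Normal] (n : ℕ) : (localLayer
    E κ (MulAction.stabilizer (absoluteGaloisGroup E) θ) n).Normal := by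
  haveI := normal_localLayer_top E κ n
  rw [localLayer_eq_inf]
  infer_instance

/-- Membership in the layer seen from `S`: in `S` and in `Γ_n`. [folklore] -/
theorem mem_localLayer_stabilizer_iff {n : ℕ} {σ : absoluteGaloisGroup E} :
    σ ∈ localLayer E κ (MulAction.stabilizer (absoluteGaloisGroup E) θ) n ↔ σ ∈ (MulAction.stabilizer
        (absoluteGaloisGroup E) θ) ∧ σ ∈ localLayer E κ ⊤ n := by
  rw [localLayer_eq_inf]; exact Subgroup.mem_inf

/-! ### §7.2 `ι` and fixed points -/

include hι₁ in
/-- For `P` fixed by `Γ_n` (on the twist), `ι P` is fixed by `S_n = S ∩ Γ_n`. [folklore] -/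
theorem untwist_mem_localFixedPoints_localLayer {n : ℕ} {P : localPoints (X.quadraticTwist d) E}
    (hP : P ∈ localFixedPoints (X.quadraticTwist d) E (localLayer E κ ⊤ n)) :
    ι P ∈ localFixedPoints X E (localLayer E κ (MulAction.stabilizer (absoluteGaloisGroup E) θ) n) := by
  intro σ hσ
  obtain ⟨hσS, hσL⟩ := (mem_localLayer_stabilizer_iff κ).mp hσ
  rw [← hι₁ σ (MulAction.mem_stabilizer_iff.mp hσS), hP σ hσL]

include hι₁ in
/-- For `P` fixed by all of `Γ_E` (a `ℚ_p`-point of the twist), `ι P` is fixed by `S`. [folklore] -/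
theorem untwist_mem_localFixedPoints_stabilizer {P : localPoints (X.quadraticTwist d) E}
    (hP : P ∈ localFixedPoints (X.quadraticTwist d) E ⊤) :
    ι P ∈ localFixedPoints X E (MulAction.stabilizer (absoluteGaloisGroup E) θ) := by
  intro σ hσ
  rw [← hι₁ σ (MulAction.mem_stabilizer_iff.mp hσ), hP σ (Subgroup.mem_top σ)]

include hι₂ in
/-- For `P` fixed by all of `Γ_E` and `τ` negating `θ`: `τ • ι P = -ι P`. [folklore] -/
theorem smul_untwist_eq_neg {P : localPoints (X.quadraticTwist d) E}
    (hP : P ∈ localFixedPoints (X.quadraticTwist d) E ⊤) {τ : absoluteGaloisGroup E} (hτ : τ • θ = -θ) :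
    τ • ι P = -ι P := by
  have h := hι₂ τ hτ P
  rw [hP τ (Subgroup.mem_top τ)] at h
  calc τ • ι P = -(-(τ • ι P)) := (neg_neg _).symm
    _ = -ι P := by rw [← h]

include hθ hι₁ hι₂ in
/-- **Descent of a point to the twist**: a point `w` of `E(K̄_E)` fixed by `S_n` and NEGATED by some
`τ ∈ Γ_n` with `τ θ = -θ` is `ι P'` for a point `P'` of the twist fixed by all of `Γ_n`. [folklore] -/
theorem symm_mem_localFixedPoints_localLayer {n : ℕ} {w : localPoints X E}
    (hw : w ∈ localFixedPoints X E (localLayer E κ (MulAction.stabilizer (absoluteGaloisGroup E) θ) n)) {τ : absoluteGaloisGroup E} (hτL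
        : τ ∈ localLayer E κ ⊤ n)
    (hτ : τ • θ = -θ) (hτw : τ • w = -w) :
    (ι).symm w ∈ localFixedPoints (X.quadraticTwist d) E (localLayer E κ ⊤ n) := by
  intro σ hσ
  apply (ι).injective
  rw [AddEquiv.apply_symm_apply]
  rcases hθ σ with hσθ | hσθ
  · rw [hι₁ σ hσθ, AddEquiv.apply_symm_apply]
    exact hw σ ((mem_localLayer_stabilizer_iff κ).mpr ⟨MulAction.mem_stabilizer_iff.mpr hσθ, hσ⟩)
  · rw [hι₂ σ hσθ, AddEquiv.apply_symm_apply]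
    have hρ : τ⁻¹ * σ ∈ localLayer E κ (MulAction.stabilizer (absoluteGaloisGroup E) θ) n :=
      (mem_localLayer_stabilizer_iff κ).mpr
        ⟨inv_mul_mem_stabilizer hτ hσθ, Subgroup.mul_mem _ (Subgroup.inv_mem _ hτL) hσ⟩
    calc -(σ • w) = -(τ • ((τ⁻¹ * σ) • w)) := by rw [← mul_smul, mul_inv_cancel_left]
      _ = w := by rw [hw _ hρ, hτw, neg_neg]

/-! ### §7.3 The norm of `ℚ_{p,n}`-points of the twist is the `K_n/K_𝔭`-norm after `ι` -/

include hθ hp2 hι₁ in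
/-- **`ι ∘ N_{Γ_E/Γ_n} = N_{S/S_n} ∘ ι` on `Γ_n`-fixed points of the twist** (coset representatives
in `S`, where `ι` is equivariant). [folklore] -/
theorem untwist_localNorm_top (n : ℕ) (P : localPoints (X.quadraticTwist d) E)
    (hP : P ∈ localFixedPoints (X.quadraticTwist d) E (localLayer E κ ⊤ n)) :
    ι
        ((localNorm (W := X.quadraticTwist d) ⊤ (localLayer E κ ⊤ n) ⟨P, hP⟩ :
          localFixedPoints (X.quadraticTwist d) E ⊤) : localPoints (X.quadraticTwist d) E) =
      ((localNorm (W := X) (MulAction.stabilizer (absoluteGaloisGroup E) θ) (localLayer E κ (MulAction.stabilizer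
          (absoluteGaloisGroup E) θ) n)
          ⟨ι P, untwist_mem_localFixedPoints_localLayer X ι hι₁ κ hP⟩ :
        localFixedPoints X E (MulAction.stabilizer (absoluteGaloisGroup E) θ)) : localPoints X E) :=
  map_localNorm_top_eq_localNorm (ι).toAddMonoidHom
    (fun s hs Q ↦ hι₁ s (MulAction.mem_stabilizer_iff.mp hs) Q)
    (exists_stabilizer_mul_layer hθ κ hp2 n) P hP _

/-! ### §7.4 Step A: on `ℚ_p`-points, universal norms over `ℚ_p` = universal norms over `K_𝔭` -/

include hθ hp2 in
/-- A universal norm over `ℚ_p` is a universal norm over `K_𝔭`. [folklore] -/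
theorem mem_universalNorms_stabilizer_of_top {m : localPoints X E} (hm : m ∈ localFixedPoints X E ⊤)
    (hN : (⟨m, hm⟩ : localFixedPoints X E ⊤) ∈ localUniversalNorms E κ ⊤ (W := X)) :
    (⟨m, localFixedPoints_antitone le_top hm⟩ : localFixedPoints X E (MulAction.stabilizer (absoluteGaloisGroup E)
        θ)) ∈
      localUniversalNorms E κ (MulAction.stabilizer (absoluteGaloisGroup E) θ) (W := X) := by
  rw [mem_localUniversalNorms_iff] at hN ⊢
  intro n
  obtain ⟨y, hy⟩ := hN n
  refine ⟨⟨y, mem_localFixedPoints_localLayer_of_top X y.2⟩, Subtype.ext ?_⟩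
  rw [coe_localNorm_eq_coe_localNorm_top (exists_stabilizer_mul_layer hθ κ hp2 n) (y : localPoints X E) y.2]
  exact congrArg Subtype.val hy

include hθ hp2 in
/-- A `ℚ_p`-point which is a universal norm over `K_𝔭` has its DOUBLE a universal norm over `ℚ_p`
(symmetrise a `K_n`-preimage by an involution of the layer). [folklore] -/
theorem two_nsmul_mem_universalNorms_top_of_stabilizer [(MulAction.stabilizer (absoluteGaloisGroup E) θ).Normal] (hτ
    : ∃ τ : absoluteGaloisGroup E, τ • θ ≠ θ)
    {m : localPoints X E} (hm : m ∈ localFixedPoints X E ⊤)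
    (hN : (⟨m, localFixedPoints_antitone le_top hm⟩ : localFixedPoints X E (MulAction.stabilizer (absoluteGaloisGroup
        E) θ)) ∈
      localUniversalNorms E κ (MulAction.stabilizer (absoluteGaloisGroup E) θ) (W := X)) :
    (2 : ℕ) • (⟨m, hm⟩ : localFixedPoints X E ⊤) ∈ localUniversalNorms E κ ⊤ (W := X) := by
  rw [mem_localUniversalNorms_iff] at hN ⊢
  intro n
  haveI := normal_localLayer_stabilizer κ (θ := θ) n
  obtain ⟨w, hw⟩ := hN n
  obtain ⟨τ, hτL, hτ⟩ := exists_mem_layer_smul_eq_neg hθ κ hp2 hτ n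
  have hτ2 : τ * τ ∈ localLayer E κ (MulAction.stabilizer (absoluteGaloisGroup E) θ) n :=
    (mem_localLayer_stabilizer_iff κ).mpr ⟨by rw [← pow_two]; exact sq_mem_stabilizer hτ,
      Subgroup.mul_mem _ hτL hτL⟩
  -- the symmetrised preimage `y = w + τ w` is fixed by all of `Γ_n`
  have hτw : τ • (w : localPoints X E) ∈ localFixedPoints X E (localLayer E κ (MulAction.stabilizer
      (absoluteGaloisGroup E) θ) n) :=
    smul_mem_localFixedPoints_of_normal X _ τ w.2
  have hy : (w : localPoints X E) + τ • (w : localPoints X E) ∈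
      localFixedPoints X E (localLayer E κ ⊤ n) := by
    intro σ hσ
    rcases hθ σ with hσθ | hσθ
    · have hσ' : σ ∈ localLayer E κ (MulAction.stabilizer (absoluteGaloisGroup E) θ) n :=
        (mem_localLayer_stabilizer_iff κ).mpr ⟨MulAction.mem_stabilizer_iff.mpr hσθ, hσ⟩
      rw [smul_add, w.2 σ hσ', hτw σ hσ']
    · have hρ : τ⁻¹ * σ ∈ localLayer E κ (MulAction.stabilizer (absoluteGaloisGroup E) θ) n :=
        (mem_localLayer_stabilizer_iff κ).mpr
          ⟨inv_mul_mem_stabilizer hτ hσθ, Subgroup.mul_mem _ (Subgroup.inv_mem _ hτL) hσ⟩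
      calc σ • ((w : localPoints X E) + τ • (w : localPoints X E))
          = τ • ((τ⁻¹ * σ) • ((w : localPoints X E) + τ • (w : localPoints X E))) := by
            rw [← mul_smul, mul_inv_cancel_left]
        _ = τ • (w : localPoints X E) + (τ * τ) • (w : localPoints X E) := by
            rw [smul_add, w.2 _ hρ, hτw _ hρ, smul_add, mul_smul]
        _ = (w : localPoints X E) + τ • (w : localPoints X E) := by
            rw [w.2 _ hτ2, add_comm]
  refine ⟨⟨_, hy⟩, Subtype.ext ?_⟩
  -- its norm over `ℚ_p` is its norm over `K_𝔭`, namely `m + τ m = 2m`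
  rw [← coe_localNorm_eq_coe_localNorm_top (exists_stabilizer_mul_layer hθ κ hp2 n) _ hy]
  have hsplit : (⟨(w : localPoints X E) + τ • (w : localPoints X E),
      mem_localFixedPoints_localLayer_of_top X hy⟩ : localFixedPoints X E (localLayer E κ (MulAction.stabilizer
          (absoluteGaloisGroup E) θ) n)) =
      w + ⟨τ • (w : localPoints X E), hτw⟩ := rfl
  rw [hsplit, map_add, AddSubgroup.coe_add, coe_localNorm_smul X (MulAction.stabilizer (absoluteGaloisGroup E) θ) _ τ
      (w : localPoints X E) w.2]
  have hw' : ((localNorm (W := X) (MulAction.stabilizer (absoluteGaloisGroup E) θ) (localLayer E κ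
      (MulAction.stabilizer (absoluteGaloisGroup E) θ) n) ⟨(w : localPoints X E), w.2⟩ :
      localFixedPoints X E (MulAction.stabilizer (absoluteGaloisGroup E) θ)) : localPoints X E) = m := by
    rw [Subtype.coe_eta, hw]
  rw [hw', hm τ (Subgroup.mem_top τ), AddSubmonoidClass.coe_nsmul, two_nsmul]

include hθ hp2 in
/-- **Step A.** For a `ℚ_p`-point `m`, when `[E(ℚ_p) : N_∞^{ℚ_p}]` is odd: `m` is a universal norm over
`ℚ_p` iff it is one over `K_𝔭`. [folklore] -/
theorem mem_universalNorms_top_iff_stabilizer [(MulAction.stabilizer (absoluteGaloisGroup E) θ).Normal] (hτ : ∃ τ :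
    absoluteGaloisGroup E, τ • θ ≠ θ)
    (hodd : Odd (localUniversalNormIndex E κ ⊤ (W := X)))
    {m : localPoints X E} (hm : m ∈ localFixedPoints X E ⊤) :
    (⟨m, hm⟩ : localFixedPoints X E ⊤) ∈ localUniversalNorms E κ ⊤ (W := X) ↔
      (⟨m, localFixedPoints_antitone le_top hm⟩ : localFixedPoints X E (MulAction.stabilizer (absoluteGaloisGroup E)
          θ)) ∈
        localUniversalNorms E κ (MulAction.stabilizer (absoluteGaloisGroup E) θ) (W := X) :=
  ⟨mem_universalNorms_stabilizer_of_top X hθ κ hp2 hm, fun h ↦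
    mem_of_two_nsmul_mem_of_odd_index _ hodd
      (two_nsmul_mem_universalNorms_top_of_stabilizer X hθ κ hp2 hτ hm h)⟩

end Main

end Summit.BirchSwinnertonDyer.Rank1Residual.Additive.UniversalNormTwist

end
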